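import Summits.QuantumFields.YangMills.Theorems.BalabanUVNodesN20KeyedRelWeightCutZero
import Summits.QuantumFields.YangMills.Theorems.BalabanUVNodesN19MGFRoadLiveSelectorTower
import Summits.QuantumFields.YangMills.Theorems.BalabanUVNodesN21StepWeightsPositivity
import Summits.QuantumFields.YangMills.Theorems.BalabanUVNodesN21ShellSplitOfRecord13CoPH
import Literature.MathematicalPhysics.QuantumFieldTheory.Balaban1983to89.T4MatchingAssembly

/-!
# BalabanUVNodes ∕ N21 face at the spine reading of record — LOCATED, KERNEL FORM: AT THE ZERO SHELL SPLIT THE N21 CONJUNCT OF K3⁷ v2 STUB 2 IS FREE.  The keyed class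
# weights of record `weightA₁₃ ∕ weightB₁₃` are NON-NEGATIVE at every Stage-13 tuple with core provisos — F3's dressed slots are `≥ 0` for ANY selector (dag-n19-c) once the
# step weights are, and `0 ≤ ζ` is FORCED by the provisos' own rows `zetaUnity` (`Σ ζ = 1`) and `zetaAbs` (`Σ |ζ| ≤ 1`) (dag-n21-d) — so `ShellWeightBound` holds at
# `crOfRecord₁₃At K₀ jcut (zero split)` with zero shells and zero shell weight, for EVERY tuple and EVERY cut policy; with module `…N20KeyedRelWeightCutZero` the dial
# `(jcut, sh) = (0, 0)` leaves stub 2 with exactly: `PinnedAtLive` (rfl) ∧ N20 (free) ∧ N21 (free) ∧ N27x (dag-n20-d's theorem on the live line) ∧ THE CORE EDGE ON EVERY HISTORY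

Cell `pub-ymgap` (HUMAN RULING D-0062 Track A; work-bound push D-0149, director-ym №197), width seat `pub-ymgap-dag-n20-w2` (gen 0); sixth module, the N21-face companion of
module 5 `…N20KeyedRelWeightCutZero` (p590852; plan g80 WORDS-1a (a): «the `∃` of stub 2 is the prover's dial — intended»).  Filed `--kind proof --supports
stmt-QuantumFields-20544 --as helper` (K3⁷ `SpineGivenEndpointR13SepCoPH`); COUNT-NEUTRAL; LOCATED (it proves no estimate — it says the zero end of the shell dial costs nothing
at the (2.18) index of record).  [III] = [Balaban1988Convergent], [LF-I] = [Balaban1989LargeFieldI], [LF-II] = [Balaban1989LargeFieldII].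

WHY.  K3⁷ v2 stub 2 (plan g79, 145a664ea9c38a7b) reads «`∃ (jcut) (sh : ShellSplit₁₃CoPH 2 0) (cr), PinnedAtLive jcut sh cr ∧ KeyedRelWeight cr ∧ KeyedShellWeight cr ∧
KeyedExtraction cr ∧ KeyedCoreEdgeHolderD4 β cr rr`».  `T4IndicatorShell.ShellWeightBound` with ZERO shells asks only that the keyed weights be NON-NEGATIVE
(`T4MatchingAssembly.shellWeightBound_zero`).  This file shows that non-negativity IS in the tree BY NAME at every tuple `(θ : Stage13HParams F N, hP : θ.Provisos₁₃CoPH F N)`: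
* §1 CITED: dag-n21-d's `N21ShellSplitOfRecord13CoPH.classWeightOfDatum₉_nonneg'` (p592363) — `∫ χ_k(s)·slot ≥ 0` (dag-n19-c's `dressedSlotsOfDatum₉_nonneg`, ANY selector) at
  non-negative step weights; NOT re-declared here;
* §2 `zeta_nonneg_of_provisos₁₃CoPH` (dag-n21-d's `N21StepWeightsPositivity.zetaOfRecord_nonneg` on `hP.zetaUnity`, `hP.zetaAbs`: `Σ ζ = 1 ∧ Σ |ζ| ≤ 1 ⇒ ζ ≥ 0`) ·
  `wOfRecord₉_nonneg_of_provisos₁₃CoPH` (`Node00.wOfRecord_nonneg`) — the letter `hζ0` ∕ «`0 ≤ ζ`» of the record files is NOT an extra input at such a tuple;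
* §3 `weightA₁₃_nonneg` · `weightB₁₃_nonneg` (fibre sums of §1) — these also discharge the non-negativity letters `hP0` ∕ `hA` ∕ `hB` that dag-n20-d's `core_crOfRecord₁₃At` and
  dag-n20-w3's reading modules display WHEN the shells are zero;
* §4 ★ `shellWeightBound_carriers₁₃_shellZero` · ★★ `shellWeightBound_crOfRecord₁₃At_shellZero` (dag-n20-d's `shellWeightBound_crOfRecord₁₃At` transfers the zero witness to the
  canonical `wshInf`) · ★★ `keyedShellWeight_shape_crOfRecord₁₃_shellZero` (the skeleton's `KeyedShellWeight (crOfRecord₁₃ jcut (zero split))` body VERBATIM at `N = 2`, every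
  guarded admissible tuple, EVERY `jcut`);
* §5 `lt_one_crOfRecord₁₃At_zeroDial` (U4′'s `W + Wsh < 1` at `(jcut, sh) = (0, 0)` with both canonical weights, dag-n20-d's `lt_one_crOfRecord₁₃At`).
WHAT FOLLOWS FOR THE SKELETON (located; plan g80 (a) already rules the dials intended): at the witness `(jcut, sh) = (fun _ ↦ 0, zero split)` the conjuncts `PinnedAtLive`
(`rfl`), `KeyedRelWeight` (module 5) and `KeyedShellWeight` (this file) are THEOREMS with no hypothesis; `KeyedExtraction` is dag-n20-d's `keyedExtraction_crOfRecord₁₃At` on the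
live line under (H-U) (its `0 ≤ ζ` letter is §2 here); so the IRREDUCIBLE content of stub 2 at that witness is `KeyedCoreEdgeHolderD4 β (crOfRecord₁₃ 0 0) (rrOfRecord 𝔯 ksel)`
with `Bad = ∅` and NO shell allowance — the EXACT NE7 core on EVERY keyed class given the R-β rates, read term-by-lifted-term by dag-n20-w3's modules and this seat's fibre modules.
Every positive `jcut` ∕ non-zero `sh` trades part of that for NE7b- ∕ NE7c-shaped relative-weight bounds; the closing proof's choice decides the N20 ∕ N21 bookings (plan g80).
Cited BY NAME, not re-typed: dag-n20-d `…SpineReadingOfRecord13CoPH` (`classSet₁₃`, `weightA₁₃`, `weightB₁₃`, `runA₁₃∕runB₁₃`, `histA₁₃∕histB₁₃`, `crOfRecord₁₃At`, `crOfRecord₁₃`,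
`shellWeightBound_crOfRecord₁₃At`, `lt_one_crOfRecord₁₃At`), dag-n19-c `…N19MGFRoadLiveSelectorTower` (`dressedSlotsOfDatum₉_nonneg`), dag-n21-d `…N21StepWeightsPositivity`
(`zetaOfRecord_nonneg`), `Node00` (`chiSeqOfRecord_nonneg`, `wOfRecord_nonneg`, `datumOfRecord₁₃CoPH`), `T4MatchingAssembly.shellWeightBound_zero`, module 5.

HONEST FRAMING.  Bookkeeping; NO estimate; LOCATED = a reading of the registered stub text, count-neutral; it does NOT say NE7c is false or vacuous as mathematics — it says
the zero shell split makes the N21 FACE free at the (2.18) index of record, the shell content then sitting inside the core edge.  Nothing of Bałaban's is asserted; NE7 ∕ NE7b ∕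
NE7c NOT PRINTED for `d = 4`, NOT proved; N19 ∕ N20 ∕ N21 ∕ N27 NOT discharged; K3⁷ NOT closed (stub 1 and stub 2's core conjunct untouched); counts unmoved (typed 28∕28 · discharged
5∕27); no count claim.  One finite `𝕋⁴_{L^K}` programme at fixed `ε = L^{−K}`, Bałaban AS PRINTED; the YM mass gap (Clay) is NOT proved by any of this — R4 closes the conditional
finite-𝕋⁴ rung `BalabanLadder.UV` only; NOT ℝ⁴, NOT OS.  No `def`, no `instance`, no `notation`, no `sorry`.
Sources (bookkeeping): [III] (2.18) p.257, (3.2)–(3.5) p.265, (3.16) p.268, (3.21) p.269, (3.24) p.270; [LF-I] (0.2)–(0.4) p.176; [LF-II] Thm 1 + (0.1) pp.355–356; [King1986] (3.10)–(3.11) p.656.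
-/

noncomputable section

open scoped BigOperators
open MeasureTheory

namespace Summit.QuantumFields.YangMills.BalabanUVNodes.N21KeyedShellWeightShellZero

open Literature.MathematicalPhysics.QuantumFieldTheory.Balaban1983to89 Literature.MathematicalPhysics.QuantumFieldTheory.Balaban1983to89.Node00
open T4Continuum
open T4WeightBudget (RelWeightBound)
open T4IndicatorShell (ShellWeightBound)
open YMDAG.UVSplit hiding SU
open Summit.QuantumFields.YangMills.Theorems.N21ShellSplitOfRecord13CoPH (classWeightOfDatum₉_nonneg')
open Summit.QuantumFields.YangMills.Theorems.N21StepWeightsPositivity (zetaOfRecord_nonneg)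
open Summit.QuantumFields.YangMills.BalabanUVNodes.N20KeyedRelWeightCutZero (relWeightBound_carriers₁₃_cutZero)

variable (F : T4Family) {N : ℕ} [NeZero N]

/-! ## §1  (dag-n21-d, `…N21ShellSplitOfRecord13CoPH.classWeightOfDatum₉_nonneg'`): F3's dressed class weights are `≥ 0` at non-negative step weights, ANY selector — CITED -/

/-! ## §2  At a Stage-13 tuple with core provisos the step weights ARE non-negative: `Σ ζ = 1` and `Σ |ζ| ≤ 1` force `ζ ≥ 0` -/

/-- **`0 ≤ ζ` FROM THE PROVISOS** (rows `zetaUnity`, `zetaAbs` of `Provisos₁₃CoPH`; dag-n21-d's `zetaOfRecord_nonneg`): the residual fluctuation factor of a Stage-13 tuple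
with core provisos is termwise non-negative — the letter `hζ0` of the record files is NOT an extra input at such a tuple. [cite: Balaban1988Convergent, (3.16) p.268, (3.21) p.269 (bookkeeping)] -/
theorem zeta_nonneg_of_provisos₁₃CoPH (θ : Stage13HParams F N) (hP : θ.Provisos₁₃CoPH F N) :
    ∀ p g k s Pl Ql RS U V', 0 ≤ θ.ζ p g k s Pl Ql RS U V' :=
  zetaOfRecord_nonneg F N θ.ν θ.τ9.M hP.zetaUnity hP.zetaAbs

/-- **`0 ≤` THE STEP WEIGHTS OF RECORD of a Stage-13 tuple with core provisos** (`wOfRecord_nonneg` at `0 ≤ ζ`). [cite: Balaban1988Convergent, (3.2)–(3.5) p.265, (3.16) p.268 (bookkeeping)] -/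
theorem wOfRecord₉_nonneg_of_provisos₁₃CoPH (θ : Stage13HParams F N) (hP : θ.Provisos₁₃CoPH F N) (p : B12.RunParams) (g : ℕ → ℝ) (k : ℕ)
    (s' : SeqOfRecord F θ.ν θ.τ9.M g p.K (k + 1)) (U : GaugeField (F.P p.K) k (SU N)) (V' : GaugeField (F.P p.K) (k + 1) (SU N)) :
    0 ≤ wOfRecord₉ F N θ.toStage9Params p g k s' U V' :=
  wOfRecord_nonneg F N θ.ν θ.τ9.M p g k θ.A₁ (zeta_nonneg_of_provisos₁₃CoPH F θ hP) s' U V'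

/-! ## §3  The keyed class weights of the spine reading of record are non-negative -/

/-- **`0 ≤ weightA₁₃`**: run A's keyed class weight of record (a fibre sum of F3's class weights at the tuple's own datum) is non-negative at every Stage-13 tuple with core
provisos — every step, source and key. [cite: Balaban1988Convergent, (2.18) p.257; King1986, (3.10) p.656 (bookkeeping)] -/
theorem weightA₁₃_nonneg (θ : Stage13HParams F N) (hP : θ.Provisos₁₃CoPH F N) (K₀ : ℕ) (g₀ : ℕ → ℝ) (os : List (ULoop F)) (K : ℕ) (t : ℝ)
    (x : Σ K, SiteSeqKey F (K₀ + K)) : 0 ≤ weightA₁₃ θ hP K₀ g₀ os K t x := by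
  unfold weightA₁₃
  exact Finset.sum_nonneg fun s _ => classWeightOfDatum₉_nonneg' F N θ.toStage9Params (datumOfRecord₁₃CoPH F N θ hP) g₀ os (runA₁₃ F K₀ g₀ K)
    (histA₁₃ θ K₀ g₀ K) (K₀ + K) (wOfRecord₉_nonneg_of_provisos₁₃CoPH F θ hP (runA₁₃ F K₀ g₀ K) (histA₁₃ θ K₀ g₀ K)) t s

/-- **`0 ≤ weightB₁₃`**: the same for run B's keyed (block-down fibre) class weight of record. [cite: Balaban1988Convergent, (2.18) p.257; King1986, (3.10) p.656 (bookkeeping)] -/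
theorem weightB₁₃_nonneg (θ : Stage13HParams F N) (hP : θ.Provisos₁₃CoPH F N) (K₀ : ℕ) (g₀ : ℕ → ℝ) (os : List (ULoop F)) (K : ℕ) (t : ℝ)
    (x : Σ K, SiteSeqKey F (K₀ + K)) : 0 ≤ weightB₁₃ θ hP K₀ g₀ os K t x := by
  unfold weightB₁₃
  exact Finset.sum_nonneg fun s' _ => classWeightOfDatum₉_nonneg' F N θ.toStage9Params (datumOfRecord₁₃CoPH F N θ hP) g₀ os (runB₁₃ F K₀ g₀ K)
    (histB₁₃ θ K₀ g₀ K) (K₀ + K + 1) (wOfRecord₉_nonneg_of_provisos₁₃CoPH F θ hP (runB₁₃ F K₀ g₀ K) (histB₁₃ θ K₀ g₀ K)) t s'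

/-! ## §4  Hence the N21 face AT THE ZERO SHELL SPLIT holds OUTRIGHT -/

/-- **`ShellWeightBound` AT THE READING's CARRIERS WITH ZERO SHELLS AND ZERO SHELL WEIGHT** (`T4MatchingAssembly.shellWeightBound_zero` at the non-negative keyed weights):
for EVERY Stage-13 tuple with core provisos, datum of record, `g₀`, `os` — no estimate. [cite: King1986, (3.10)–(3.11) p.656; Balaban1989LargeFieldI, (0.2)–(0.4) p.176 (bookkeeping)] -/
theorem shellWeightBound_carriers₁₃_shellZero (θ : Stage13HParams F N) (hP : θ.Provisos₁₃CoPH F N) (K₀ : ℕ) (g₀ : ℕ → ℝ) (os : List (ULoop F)) :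
    ShellWeightBound 1 (classSet₁₃ θ K₀ g₀) (weightA₁₃ θ hP K₀ g₀ os) (weightB₁₃ θ hP K₀ g₀ os) (fun _ _ _ => 0) (fun _ _ _ => 0) (fun _ => 0) :=
  T4MatchingAssembly.shellWeightBound_zero (fun K t _ x _ => weightA₁₃_nonneg F θ hP K₀ g₀ os K t x)
    (fun K t _ x _ => weightB₁₃_nonneg F θ hP K₀ g₀ os K t x)

/-- **★★ THE N21 FACE OF K3⁷ v2 STUB 2 AT `crOfRecord₁₃At K₀ jcut (zero split)` HOLDS FOR EVERY TUPLE, UNCONDITIONALLY** (the reading's canonical `Wsh = wshInf …` inherits the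
zero witness by dag-n20-d's `shellWeightBound_crOfRecord₁₃At`).  LOCATED (count-neutral): under the registered stub text «`∃ (jcut) (sh : ShellSplit₁₃CoPH 2 0) (cr), …
∧ KeyedShellWeight cr ∧ …`» the witness `sh := 0` discharges the N21 conjunct by itself — the shell split is, like the cut, the PROVER's DIAL (plan g80 WORDS-1a (a)); at its
zero setting NE7c's face is free and the core edge carries NO shell allowance. [cite: King1986, (3.10)–(3.11) p.656; Balaban1989LargeFieldII, Thm 1 + (0.1) pp.355–356 (bookkeeping)] -/
theorem shellWeightBound_crOfRecord₁₃At_shellZero (K₀ : ℕ) (jcut : ℕ → ℕ) (θ : Stage13HParams F N) (hP : θ.Provisos₁₃CoPH F N) (g₀ : ℕ → ℝ)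
    (os : List (ULoop F)) :
    ShellWeightBound (crOfRecord₁₃At K₀ jcut (fun _ _ _ _ _ => (fun _ _ _ => 0, fun _ _ _ => 0)) F θ hP g₀ os).l₀
      (crOfRecord₁₃At K₀ jcut (fun _ _ _ _ _ => (fun _ _ _ => 0, fun _ _ _ => 0)) F θ hP g₀ os).T
      (crOfRecord₁₃At K₀ jcut (fun _ _ _ _ _ => (fun _ _ _ => 0, fun _ _ _ => 0)) F θ hP g₀ os).A
      (crOfRecord₁₃At K₀ jcut (fun _ _ _ _ _ => (fun _ _ _ => 0, fun _ _ _ => 0)) F θ hP g₀ os).B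
      (crOfRecord₁₃At K₀ jcut (fun _ _ _ _ _ => (fun _ _ _ => 0, fun _ _ _ => 0)) F θ hP g₀ os).shA
      (crOfRecord₁₃At K₀ jcut (fun _ _ _ _ _ => (fun _ _ _ => 0, fun _ _ _ => 0)) F θ hP g₀ os).shB
      (crOfRecord₁₃At K₀ jcut (fun _ _ _ _ _ => (fun _ _ _ => 0, fun _ _ _ => 0)) F θ hP g₀ os).Wsh :=
  shellWeightBound_crOfRecord₁₃At K₀ jcut _ θ hP g₀ os (shellWeightBound_carriers₁₃_shellZero F θ hP K₀ g₀ os)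

/-- **★★ THE `KeyedShellWeight` BINDER SHAPE OF THE REGISTERED K3⁷ v2 SKELETON AT `crOfRecord₁₃ jcut (zero split)`, SPELLED OUT** (`N = 2`, every guarded admissible Stage-13
tuple with core provisos, every `g₀`, `os`; the guards unused): the N21 conjunct of `stub_expansion13H` at the zero shell split, for EVERY cut policy `jcut`.
[cite: King1986, (3.10)–(3.11) p.656; Balaban1989LargeFieldII, Thm 1 + (0.1) pp.355–356 (bookkeeping)] -/
theorem keyedShellWeight_shape_crOfRecord₁₃_shellZero (jcut : ℕ → ℕ) :
    ∀ (F : T4Family) (θ : Stage13HParams F 2) (hP : θ.Provisos₁₃CoPH F 2), (θ.ZhUnity F 2 ∧ θ.SlotsNondegenerate₁₃ F 2) → θ.Admissible F 2 →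
      ∀ (g₀ : ℕ → ℝ) (os : List (ULoop F)),
        ShellWeightBound (crOfRecord₁₃ jcut (fun _ _ _ _ _ => (fun _ _ _ => 0, fun _ _ _ => 0)) F θ hP g₀ os).l₀
          (crOfRecord₁₃ jcut (fun _ _ _ _ _ => (fun _ _ _ => 0, fun _ _ _ => 0)) F θ hP g₀ os).T
          (crOfRecord₁₃ jcut (fun _ _ _ _ _ => (fun _ _ _ => 0, fun _ _ _ => 0)) F θ hP g₀ os).A
          (crOfRecord₁₃ jcut (fun _ _ _ _ _ => (fun _ _ _ => 0, fun _ _ _ => 0)) F θ hP g₀ os).B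
          (crOfRecord₁₃ jcut (fun _ _ _ _ _ => (fun _ _ _ => 0, fun _ _ _ => 0)) F θ hP g₀ os).shA
          (crOfRecord₁₃ jcut (fun _ _ _ _ _ => (fun _ _ _ => 0, fun _ _ _ => 0)) F θ hP g₀ os).shB
          (crOfRecord₁₃ jcut (fun _ _ _ _ _ => (fun _ _ _ => 0, fun _ _ _ => 0)) F θ hP g₀ os).Wsh :=
  fun F θ hP _ _ g₀ os => shellWeightBound_crOfRecord₁₃At_shellZero F 0 jcut θ hP g₀ os

/-! ## §5  … and at the zero dial `(jcut, sh) = (0, 0)` U4′'s `W + Wsh < 1` holds with both canonical weights -/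

/-- **AT `(jcut, sh) = (0, 0)` THE READING's CANONICAL WEIGHTS SATISFY `W K + Wsh K < 1`** (both faces have the zero witness: module `…N20KeyedRelWeightCutZero`'s
`relWeightBound_carriers₁₃_cutZero` and §4; dag-n20-d's `lt_one_crOfRecord₁₃At`). [cite: King1986, (3.10)–(3.11) p.656 (bookkeeping)] -/
theorem lt_one_crOfRecord₁₃At_zeroDial (K₀ : ℕ) (θ : Stage13HParams F N) (hP : θ.Provisos₁₃CoPH F N) (g₀ : ℕ → ℝ) (os : List (ULoop F)) (K : ℕ) :
    (crOfRecord₁₃At K₀ (fun _ => 0) (fun _ _ _ _ _ => (fun _ _ _ => 0, fun _ _ _ => 0)) F θ hP g₀ os).W K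
      + (crOfRecord₁₃At K₀ (fun _ => 0) (fun _ _ _ _ _ => (fun _ _ _ => 0, fun _ _ _ => 0)) F θ hP g₀ os).Wsh K < 1 :=
  lt_one_crOfRecord₁₃At K₀ _ _ θ hP g₀ os (relWeightBound_carriers₁₃_cutZero F θ hP K₀ g₀ os)
    (shellWeightBound_carriers₁₃_shellZero F θ hP K₀ g₀ os) (fun _ => by norm_num) K

end Summit.QuantumFields.YangMills.BalabanUVNodes.N21KeyedShellWeightShellZero

end
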